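import Mathlib
import HarnessLib
import Literature.MathematicalPhysics.StatisticalMechanics.FluctuationKernelComparisonTrace
import Literature.Probability.Distributions.GaussianMarginalTransfer

/-!
# Lemma 8.4 (`ℓ = 1`), dimension-free, with the comparison carried out on an AUXILIARY (small) torus
# ([Buc16] Lemma 4.1 + Thm 4.5: the localisation engine of the volume-uniform bound)

`FluctuationKernelComparisonTrace.tayNormLE_fluct_sub_fluct_of_sum_sq` compares the two fluctuation
integrals on the torus `(ℤ/M)^d` carrying the field, pricing the change by the Hilbert–Schmidt size
`h_T` of the relative change of ALL `M^d` multipliers.  For an `X`-LOCAL functional ([Buc16] Lemma 4.1)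
the comparison may instead be carried out on any auxiliary torus `(ℤ/M̄)^d` with kernels `𝒞a', 𝒞b'`
that reproduce the two covariances on the support `S` of the functional
(`𝒞•'(e x − e y) = 𝒞•(x − y)` for `x, y ∈ S`, `e` the projection): the expectation of a functional of
`(ζ_x)_{x ∈ S}` depends only on the covariance on `S` (`GaussianMarginalTransfer`), and so do its `L^p`
norms, which are therefore still controlled by the weight bounds (w7′) of the BIG torus along the kernel
segment.  The price becomes the Hilbert–Schmidt size of the relative change of the multipliers of the
SMALL torus:

* **`tayNormLE_fluct_sub_fluct_of_sum_sq_transfer`** —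
  `‖fluct 𝒞a K − fluct 𝒞b K‖_{T, w_{k:k+1}^X} ≤ C · ((r₀+1) · (8 q h_S) · (A𝒫p^{|X|_k})^{1/p})` whenever the
  gauge `T` only sees the field on `S`, the auxiliary even kernels have nonnegative multipliers
  (positive off the zero mode) with a mode-wise two-sided relative bound `ρ'` on `(ℤ/M̄)^d`,
  `Σ_{κ'} ρ'(κ')² ≤ h_S²`.

With the re-periodised kernels of `TorusKernelReperiodisation` (`𝒞•' = 𝒞• ∘ lift`, `M̄ = L^{N̄} ≳ diam S`)
this is the volume-uniform Lemma 8.4 of [ABKM19] (assembly not in this file).  Everything is proved; no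
named fact.

## References
* S. Buchholz, J. Funct. Anal. 275 (2018), Lemma 4.1, Thm 4.5 [Buchholz2016].
* S. Adams, S. Buchholz, R. Kotecký, S. Müller, arXiv:1910.13564, Lemma 8.4 [AdamsBuchholzKoteckyMuller2019].
-/

noncomputable section

namespace Literature.MathematicalPhysics.StatisticalMechanics.GradientRG

open scoped BigOperators Matrix ENNReal
open MeasureTheory ProbabilityTheory Finset WithLp Matrix
open Literature.MathematicalPhysics.StatisticalMechanics.GradientFRD (mulMat fourierCoeff
  re_fourierCoeff_zero_of_sum_eq_zero circulant_eq_mulMat posSemidef_mulMat)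
open Literature.MathematicalPhysics.StatisticalMechanics.TorusPolymer (IsPolymer numBlocks)
open Literature.MathematicalPhysics.QuantumFieldTheory
open Literature.Probability.Distributions (integral_comp_sel_multivariateGaussian_eq
  integrable_comp_sel_multivariateGaussian_iff)

variable {d M Mb : ℕ} [NeZero M] [NeZero Mb]

/-! ## Extension by zero off a finite set and pull-back along a map of sites -/

omit [NeZero M] in
/-- The entries of the regularised circulant covariance. [cite: AdamsBuchholzKoteckyMuller2019, Ch. 6.1 (6.23)] -/
theorem circulant_add_constMat_apply (𝒞 : (Fin d → ZMod M) → ℝ) (c : ℝ) (x y : Fin d → ZMod M) :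
    (Matrix.circulant 𝒞 + constMat c : Matrix (Fin d → ZMod M) (Fin d → ZMod M) ℝ) x y = 𝒞 (x - y) + c := by
  simp only [Matrix.add_apply, Matrix.circulant_apply, constMat, Matrix.of_apply]

set_option maxHeartbeats 1600000 in
/-- **[ABKM19] Lemma 8.4 (`ℓ = 1`), dimension-free, comparison on an auxiliary torus** (module docstring).
Big torus `(ℤ/M)^d`: local dominated weights `W`, even zero-sum step kernels `𝒞a, 𝒞b` with
`StepKernelBounds` at scale `k`, positive multipliers off the zero mode, and `StepKernelBounds` for the
dilated kernel segment `p·(𝒞b + t(𝒞a − 𝒞b))`; a gauge `T` killing constants and seeing the field only on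
the finite set `S`; a `T`-local `C^{r₀}` functional `K` with `‖K‖_{T,w_k^X} ≤ C`.  Auxiliary torus
`(ℤ/M̄)^d`: a map of sites `e` and even kernels `𝒞a', 𝒞b'` with nonnegative multipliers, positive off
the zero mode, reproducing the covariances on `S` (`𝒞•'(e x − e y) = 𝒞•(x − y)`, `x, y ∈ S`), and a
mode-wise two-sided relative bound `ρ' ≥ 0` with `Σ ρ'² ≤ h_S²`.  Then
`‖fluct 𝒞a K − fluct 𝒞b K‖_{T, w_{k:k+1}^X} ≤ C · ((r₀+1) · (8 q h_S) · (A𝒫p^{|X|_k})^{1/p})`.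
[cite: Buchholz2016, Lemma 4.1 / Thm 4.5] -/
theorem tayNormLE_fluct_sub_fluct_of_sum_sq_transfer (W : WeightData (Fin d → ZMod M))
    {nb : ℕ → Finset (Fin d → ZMod M) → Finset (Fin d → ZMod M)} (hWl : W.Local nb)
    {Dm : ℕ → Matrix (Fin d → ZMod M) (Fin d → ZMod M) ℝ} (hD : W.Dominated Dm)
    {L k : ℕ} {A𝒫a A𝒫b A𝒫p C₂a C₂b C₂p : ℝ} {𝒞a 𝒞b : (Fin d → ZMod M) → ℝ}
    (hSa : StepKernelBounds W L k A𝒫a C₂a 𝒞a) (hSb : StepKernelBounds W L k A𝒫b C₂b 𝒞b)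
    {p q : ℝ} (hpq : p.HolderConjugate q)
    (hSp : ∀ t ∈ Set.Icc (0 : ℝ) 1,
      StepKernelBounds W L k A𝒫p C₂p (fun x => p * (𝒞b x + t * (𝒞a x - 𝒞b x))))
    (hea : ∀ x, 𝒞a (-x) = 𝒞a x) (heb : ∀ x, 𝒞b (-x) = 𝒞b x)
    (h0a : ∑ x, 𝒞a x = 0) (h0b : ∑ x, 𝒞b x = 0)
    (hposa : ∀ κ, κ ≠ 0 → 0 < (fourierCoeff 𝒞a κ).re)
    (hposb : ∀ κ, κ ≠ 0 → 0 < (fourierCoeff 𝒞b κ).re)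
    -- the auxiliary torus
    (e : (Fin d → ZMod M) → (Fin d → ZMod Mb)) (S : Finset (Fin d → ZMod M))
    {𝒞a' 𝒞b' : (Fin d → ZMod Mb) → ℝ}
    (hea' : ∀ z, 𝒞a' (-z) = 𝒞a' z) (heb' : ∀ z, 𝒞b' (-z) = 𝒞b' z)
    (hnna' : ∀ κ, 0 ≤ (fourierCoeff 𝒞a' κ).re) (hnnb' : ∀ κ, 0 ≤ (fourierCoeff 𝒞b' κ).re)
    (hposa' : ∀ κ, κ ≠ 0 → 0 < (fourierCoeff 𝒞a' κ).re)
    (hposb' : ∀ κ, κ ≠ 0 → 0 < (fourierCoeff 𝒞b' κ).re)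
    (hcova : ∀ x ∈ S, ∀ y ∈ S, 𝒞a' (e x - e y) = 𝒞a (x - y))
    (hcovb : ∀ x ∈ S, ∀ y ∈ S, 𝒞b' (e x - e y) = 𝒞b (x - y))
    {ρ : (Fin d → ZMod Mb) → ℝ} (hρ : ∀ κ, 0 ≤ ρ κ)
    (hcmpa : ∀ κ, |(fourierCoeff 𝒞a' κ).re - (fourierCoeff 𝒞b' κ).re| ≤ ρ κ * (fourierCoeff 𝒞a' κ).re)
    (hcmpb : ∀ κ, |(fourierCoeff 𝒞a' κ).re - (fourierCoeff 𝒞b' κ).re| ≤ ρ κ * (fourierCoeff 𝒞b' κ).re)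
    {hS : ℝ} (hhS : 0 ≤ hS) (hsum : ∑ κ, ρ κ ^ 2 ≤ hS ^ 2)
    -- the polymer, the gauge, the functional
    {X : Finset (Fin d → ZMod M)} (hX : IsPolymer (L ^ k) X)
    {V : Type*} [NormedAddCommGroup V] [NormedSpace ℝ V]
    (T : ((Fin d → ZMod M) → ℝ) →ₗ[ℝ] V) (hT : ∀ a : ℝ, T (fun _ => a) = 0)
    (hTloc : ∀ ζ ζ' : (Fin d → ZMod M) → ℝ, (∀ x ∈ S, ζ x = ζ' x) → T ζ = T ζ')
    {r₀ : ℕ} {K : ((Fin d → ZMod M) → ℝ) → ℂ} {C : ℝ}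
    (hC : 0 ≤ C) (hKd : ContDiff ℝ r₀ K) (hKloc : IsGaugeLocal T K)
    (hK : TayNormLE T r₀ (W.weight k X) K C) :
    TayNormLE T r₀ (W.midWeight k X) (fluct 𝒞a K - fluct 𝒞b K)
      (C * ((r₀ + 1) * (8 * q * hS) * (A𝒫p ^ numBlocks (L ^ k) X) ^ (1 / p))) := by
  classical
  intro φ
  have hp1 : 1 < p := hpq.lt
  have hp0 : 0 < p := by linarith
  have hq0 : 0 < q := by linarith [hpq.symm.lt]
  have hpE : ENNReal.ofReal p ≠ 0 := by simp [hp0]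
  set Kbar := gaugeLift T K with hKbar
  have hKbar_d : ContDiff ℝ r₀ Kbar := contDiff_gaugeLift T hKd
  set Ap := A𝒫p ^ numBlocks (L ^ k) X with hAp
  have hwm := W.midWeight_pos k X φ
  have hAp0 : 0 ≤ Ap := by
    by_contra hneg
    push Not at hneg
    have h1 := (hSp 0 ⟨le_rfl, zero_le_one⟩).pow_mul_midWeight_nonneg hX φ
    exact absurd h1 (not_le.2 (mul_neg_of_neg_of_pos hneg hwm))
  -- big torus: nonnegative multipliers and the segment
  have h0a' : 0 ≤ (fourierCoeff 𝒞a 0).re := re_fourierCoeff_zero_nonneg_of_sum_eq_zero h0a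
  have h0b' : 0 ≤ (fourierCoeff 𝒞b 0).re := re_fourierCoeff_zero_nonneg_of_sum_eq_zero h0b
  have hnna : ∀ κ, 0 ≤ (fourierCoeff 𝒞a κ).re := fun κ => by
    by_cases hκ : κ = 0
    · rw [hκ]; exact h0a'
    · exact (hposa κ hκ).le
  have hnnb : ∀ κ, 0 ≤ (fourierCoeff 𝒞b κ).re := fun κ => by
    by_cases hκ : κ = 0
    · rw [hκ]; exact h0b'
    · exact (hposb κ hκ).le
  have hpsd_t : ∀ t ∈ Set.Icc (0 : ℝ) 1,
      (Matrix.circulant (fun x => 𝒞b x + t * (𝒞a x - 𝒞b x))).PosSemidef := fun t ht =>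
    posSemidef_circulant_kernelSeg hea heb hnna hnnb ht.1 ht.2
  -- small torus: regularised multipliers
  set ma : (Fin d → ZMod Mb) → ℝ :=
    fun κ => (fourierCoeff 𝒞a' κ).re + if κ = 0 then (1 : ℝ) * (Mb : ℝ) ^ d else 0 with hma
  set mb : (Fin d → ZMod Mb) → ℝ :=
    fun κ => (fourierCoeff 𝒞b' κ).re + if κ = 0 then (1 : ℝ) * (Mb : ℝ) ^ d else 0 with hmb
  have hSa'_eq : Matrix.circulant 𝒞a' + constMat 1 = mulMat ma := circulant_add_constMat_eq_mulMat hea' 1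
  have hSb'_eq : Matrix.circulant 𝒞b' + constMat 1 = mulMat mb := circulant_add_constMat_eq_mulMat heb' 1
  have hma_pos : ∀ κ, 0 < ma κ := re_fourierCoeff_add_zeroModeMul_pos hposa' (hnna' 0) one_pos
  have hmb_pos : ∀ κ, 0 < mb κ := re_fourierCoeff_add_zeroModeMul_pos hposb' (hnnb' 0) one_pos
  have hma_ev : ∀ κ, ma (-κ) = ma κ := re_fourierCoeff_add_zeroModeMul_neg hea' 1
  have hmb_ev : ∀ κ, mb (-κ) = mb κ := re_fourierCoeff_add_zeroModeMul_neg heb' 1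
  have hdiff : ∀ κ, ma κ - mb κ = (fourierCoeff 𝒞a' κ).re - (fourierCoeff 𝒞b' κ).re := by
    intro κ; simp only [hma, hmb]; ring
  have hρb : ∀ κ, |ma κ - mb κ| ≤ ρ κ * mb κ := by
    intro κ
    rw [hdiff]
    refine (hcmpb κ).trans (mul_le_mul_of_nonneg_left ?_ (hρ κ))
    simp only [hmb]
    split_ifs <;> [exact le_add_of_nonneg_right (by positivity); exact (add_zero _).symm.le]
  have hρa : ∀ κ, |ma κ - mb κ| ≤ ρ κ * ma κ := by
    intro κ
    rw [hdiff]
    refine (hcmpa κ).trans (mul_le_mul_of_nonneg_left ?_ (hρ κ))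
    simp only [hma]
    split_ifs <;> [exact le_add_of_nonneg_right (by positivity); exact (add_zero _).symm.le]
  have hmt_eq : ∀ t : ℝ, mulMat (fun κ => mb κ + t * (ma κ - mb κ)) =
      Matrix.circulant (fun z => 𝒞b' z + t * (𝒞a' z - 𝒞b' z)) + constMat 1 := fun t =>
    mulMat_mulSeg_eq_circulant_kernelSeg_add_constMat hea' heb' 1 t
  have hpsd_t' : ∀ t ∈ Set.Icc (0 : ℝ) 1,
      (Matrix.circulant (fun z => 𝒞b' z + t * (𝒞a' z - 𝒞b' z))).PosSemidef := fun t ht =>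
    posSemidef_circulant_kernelSeg hea' heb' hnna' hnnb' ht.1 ht.2
  -- the covariance identity along the segment
  have hcov_t : ∀ (t : ℝ), ∀ x ∈ S, ∀ y ∈ S,
      (Matrix.circulant (fun x => 𝒞b x + t * (𝒞a x - 𝒞b x)) + constMat 1 :
          Matrix (Fin d → ZMod M) (Fin d → ZMod M) ℝ) x y =
        (Matrix.circulant (fun z => 𝒞b' z + t * (𝒞a' z - 𝒞b' z)) + constMat 1 :
          Matrix (Fin d → ZMod Mb) (Fin d → ZMod Mb) ℝ) (e x) (e y) := by
    intro t x hx y hy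
    rw [circulant_add_constMat_apply, circulant_add_constMat_apply, hcova x hx y hy, hcovb x hx y hy]
  -- extension by zero off `S` and the pull-back along `e`
  set ext : (↥S → ℝ) → ((Fin d → ZMod M) → ℝ) := fun u x => if hx : x ∈ S then u ⟨x, hx⟩ else 0 with hext
  have hext_cont : Continuous ext := by
    refine continuous_pi fun x => ?_
    by_cases hx : x ∈ S
    · simp only [hext, dif_pos hx]; exact continuous_apply _
    · simp only [hext, dif_neg hx]; exact continuous_const
  have hext_agree : ∀ (ζ : (Fin d → ZMod M) → ℝ), ∀ x ∈ S, ext (fun s : ↥S => ζ s) x = ζ x := by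
    intro ζ x hx; simp only [hext, dif_pos hx]
  -- `T.rangeRestrict` kills the constants
  have hTr : ∀ a : ℝ, T.rangeRestrict (fun _ : Fin d → ZMod M => a) = 0 := fun a =>
    Subtype.ext (hT a)
  have hTrloc : ∀ ζ ζ' : (Fin d → ZMod M) → ℝ, (∀ x ∈ S, ζ x = ζ' x) →
      T.rangeRestrict ζ = T.rangeRestrict ζ' := fun ζ ζ' h => Subtype.ext (hTloc ζ ζ' h)
  -- per-order estimate
  have hterm : ∀ s, s ≤ r₀ →
      ‖iteratedFDeriv ℝ s (gaugeLift T (fluct 𝒞a K - fluct 𝒞b K)) (T.rangeRestrict φ)‖ ≤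
        (s.factorial : ℝ) * C * (8 * q * hS * Ap ^ (1 / p)) * W.midWeight k X φ := by
    intro s hs
    have hs' : (s : WithTop ℕ∞) ≤ r₀ := by exact_mod_cast hs
    set G : ((Fin d → ZMod M) → ℝ) → _ :=
      fun ζ => iteratedFDeriv ℝ s Kbar (T.rangeRestrict φ + T.rangeRestrict ζ) with hG
    -- (1) the derivative of the lift of the difference
    have hDa := hK.derivDominated_section hC hKd (hSa.weightSectionDominated hD X T)
    have hDb := hK.derivDominated_section hC hKd (hSb.weightSectionDominated hD X T)
    have hlift_a : gaugeLift T (fluct 𝒞a K) =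
        fun w => ∫ ζ, Kbar (w + T.rangeRestrict ζ) ∂(stepMeasure 𝒞a) := by
      funext w; exact gaugeLift_integral_comp_add hKloc _ w
    have hlift_b : gaugeLift T (fluct 𝒞b K) =
        fun w => ∫ ζ, Kbar (w + T.rangeRestrict ζ) ∂(stepMeasure 𝒞b) := by
      funext w; exact gaugeLift_integral_comp_add hKloc _ w
    have hDs_a : iteratedFDeriv ℝ s (gaugeLift T (fluct 𝒞a K)) (T.rangeRestrict φ) =
        ∫ ζ, G ζ ∂(stepMeasure 𝒞a) := by
      rw [hlift_a, hDa.iteratedFDeriv_integral_eq s hs]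
      refine integral_congr_ae (ae_of_all _ fun ζ => ?_)
      simp only [hG]
      rw [iteratedFDeriv_comp_add_right]
    have hDs_b : iteratedFDeriv ℝ s (gaugeLift T (fluct 𝒞b K)) (T.rangeRestrict φ) =
        ∫ ζ, G ζ ∂(stepMeasure 𝒞b) := by
      rw [hlift_b, hDb.iteratedFDeriv_integral_eq s hs]
      refine integral_congr_ae (ae_of_all _ fun ζ => ?_)
      simp only [hG]
      rw [iteratedFDeriv_comp_add_right]
    have hca : ContDiff ℝ r₀ (gaugeLift T (fluct 𝒞a K)) :=
      contDiff_gaugeLift T (hSa.contDiff_fluct hD X T hC hKd hKloc hK)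
    have hcb : ContDiff ℝ r₀ (gaugeLift T (fluct 𝒞b K)) :=
      contDiff_gaugeLift T (hSb.contDiff_fluct hD X T hC hKd hKloc hK)
    have hsub : gaugeLift T (fluct 𝒞a K - fluct 𝒞b K) =
        gaugeLift T (fluct 𝒞a K) - gaugeLift T (fluct 𝒞b K) := by
      funext w; rfl
    rw [hsub, iteratedFDeriv_sub_apply ((hca.of_le hs').contDiffAt) ((hcb.of_le hs').contDiffAt),
      hDs_a, hDs_b]
    -- (2) properties of `G`
    have hGcont : Continuous G := by
      show Continuous fun ζ => iteratedFDeriv ℝ s Kbar (T.rangeRestrict φ + gaugeRestrictCLM T ζ)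
      exact (hKbar_d.continuous_iteratedFDeriv hs').comp
        (continuous_const.add (gaugeRestrictCLM T).continuous)
    have hGinv : ∀ (ζ : (Fin d → ZMod M) → ℝ) (a : ℝ), G (ζ + fun _ => a) = G ζ := by
      intro ζ a
      simp only [hG]
      rw [map_add, hTr a, add_zero]
    have hGloc : ∀ ζ ζ' : (Fin d → ZMod M) → ℝ, (∀ x ∈ S, ζ x = ζ' x) → G ζ = G ζ' := by
      intro ζ ζ' h
      simp only [hG]
      rw [hTrloc ζ ζ' h]
    have hGbound : ∀ ζ, ‖G ζ‖ ≤ (s.factorial : ℝ) * C * W.weight k X (φ + ζ) := by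
      intro ζ
      have hcoef := pow_div_factorial_mul_norm_iteratedFDeriv_le_tphiSeminorm r₀ zero_le_one Kbar
        (T.rangeRestrict (φ + ζ)) hs
      rw [one_pow, ← tayNorm_eq_tphiSeminorm] at hcoef
      have hfac : (0 : ℝ) < s.factorial := by positivity
      rw [div_mul_eq_mul_div, one_mul, div_le_iff₀ hfac] at hcoef
      have hpt : T.rangeRestrict φ + T.rangeRestrict ζ = T.rangeRestrict (φ + ζ) := (map_add _ _ _).symm
      simp only [hG]
      rw [hpt]
      calc ‖iteratedFDeriv ℝ s Kbar (T.rangeRestrict (φ + ζ))‖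
          ≤ tayNorm T r₀ K (φ + ζ) * s.factorial := hcoef
        _ ≤ C * W.weight k X (φ + ζ) * s.factorial :=
            mul_le_mul_of_nonneg_right (hK _) (Nat.cast_nonneg _)
        _ = (s.factorial : ℝ) * C * W.weight k X (φ + ζ) := by ring
    have hGm : Continuous fun y : EuclideanSpace ℝ (Fin d → ZMod M) => G (ofLp y) :=
      hGcont.comp (PiLp.continuous_ofLp 2 _)
    -- the functional of the restricted field and its pull-back to the small torus
    set g : (↥S → ℝ) → _ := fun u => G (ext u) with hg
    have hgcont : Continuous g := hGcont.comp hext_cont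
    have hgm : StronglyMeasurable g := hgcont.stronglyMeasurable
    have hG_eq_g : ∀ ζ : (Fin d → ZMod M) → ℝ, G ζ = g (fun s : ↥S => ζ s) := by
      intro ζ
      simp only [hg]
      exact hGloc _ _ fun x hx => (hext_agree ζ x hx).symm
    set Gs : ((Fin d → ZMod Mb) → ℝ) → _ := fun ψ => g (fun s : ↥S => ψ (e s)) with hGs
    have hpull : Continuous fun ψ : (Fin d → ZMod Mb) → ℝ => (fun s : ↥S => ψ (e s)) :=
      continuous_pi fun s : ↥S => (continuous_apply (e (s : Fin d → ZMod M)) :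
        Continuous fun ψ : (Fin d → ZMod Mb) → ℝ => ψ (e (s : Fin d → ZMod M)))
    have hGs_cont : Continuous Gs := hgcont.comp hpull
    have hGsm : Continuous fun y : EuclideanSpace ℝ (Fin d → ZMod Mb) => Gs (ofLp y) :=
      hGs_cont.comp (PiLp.continuous_ofLp 2 _)
    -- (3) transfer both expectations to the regularised Gaussians, then to the small torus
    have hreg : ∀ t ∈ Set.Icc (0 : ℝ) 1,
        (Matrix.circulant (fun x => 𝒞b x + t * (𝒞a x - 𝒞b x)) + constMat 1 :
          Matrix (Fin d → ZMod M) (Fin d → ZMod M) ℝ).PosSemidef := fun t ht =>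
      (hpsd_t t ht).add (posSemidef_constMat zero_le_one)
    have hreg' : ∀ t ∈ Set.Icc (0 : ℝ) 1,
        (Matrix.circulant (fun z => 𝒞b' z + t * (𝒞a' z - 𝒞b' z)) + constMat 1 :
          Matrix (Fin d → ZMod Mb) (Fin d → ZMod Mb) ℝ).PosSemidef := fun t ht =>
      (hpsd_t' t ht).add (posSemidef_constMat zero_le_one)
    have htransfer : ∀ (t : ℝ) (ht : t ∈ Set.Icc (0 : ℝ) 1),
        ∫ y, g (fun s : ↥S => (ofLp y) (s : Fin d → ZMod M))
            ∂(multivariateGaussian (0 : EuclideanSpace ℝ (Fin d → ZMod M))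
              (Matrix.circulant (fun x => 𝒞b x + t * (𝒞a x - 𝒞b x)) + constMat 1)) =
          ∫ y, g (fun s : ↥S => (ofLp y) (e s))
            ∂(multivariateGaussian (0 : EuclideanSpace ℝ (Fin d → ZMod Mb))
              (Matrix.circulant (fun z => 𝒞b' z + t * (𝒞a' z - 𝒞b' z)) + constMat 1)) := by
      intro t ht
      exact integral_comp_sel_multivariateGaussian_eq (hreg t ht) (hreg' t ht) (fun s : ↥S => (s : Fin d → ZMod M))
        (fun s : ↥S => e s) (fun s s' => hcov_t t s s.2 s' s'.2) hgm
    have hseg1 : (fun x => 𝒞b x + (1 : ℝ) * (𝒞a x - 𝒞b x)) = 𝒞a := by funext x; ring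
    have hseg0 : (fun x => 𝒞b x + (0 : ℝ) * (𝒞a x - 𝒞b x)) = 𝒞b := by funext x; ring
    have hseg1' : (fun z => 𝒞b' z + (1 : ℝ) * (𝒞a' z - 𝒞b' z)) = 𝒞a' := by funext z; ring
    have hseg0' : (fun z => 𝒞b' z + (0 : ℝ) * (𝒞a' z - 𝒞b' z)) = 𝒞b' := by funext z; ring
    have htra : ∫ ζ, G ζ ∂(stepMeasure 𝒞a) =
        ∫ y, Gs (ofLp y) ∂(multivariateGaussian (0 : EuclideanSpace ℝ (Fin d → ZMod Mb)) (mulMat ma)) := by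
      rw [integral_stepMeasure_eq_integral_multivariateGaussian_add_constMat hSa.posSemidef zero_le_one
        hGcont.stronglyMeasurable hGinv, ← hSa'_eq]
      have h := htransfer 1 ⟨zero_le_one, le_rfl⟩
      rw [hseg1, hseg1'] at h
      simp_rw [hG_eq_g]
      exact h
    have htrb : ∫ ζ, G ζ ∂(stepMeasure 𝒞b) =
        ∫ y, Gs (ofLp y) ∂(multivariateGaussian (0 : EuclideanSpace ℝ (Fin d → ZMod Mb)) (mulMat mb)) := by
      rw [integral_stepMeasure_eq_integral_multivariateGaussian_add_constMat hSb.posSemidef zero_le_one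
        hGcont.stronglyMeasurable hGinv, ← hSb'_eq]
      have h := htransfer 0 ⟨le_rfl, zero_le_one⟩
      rw [hseg0, hseg0'] at h
      simp_rw [hG_eq_g]
      exact h
    rw [htra, htrb]
    -- (4) the `L^p` data along the small segment, transferred from the big torus
    have hbound_p : ∀ y : EuclideanSpace ℝ (Fin d → ZMod M),
        ‖G (ofLp y)‖ ^ p ≤ ((s.factorial : ℝ) * C) ^ p * W.weight k X (φ + ofLp y) ^ p := by
      intro y
      rw [← Real.mul_rpow (by positivity) (W.weight_pos k X _).le]
      exact Real.rpow_le_rpow (norm_nonneg _) (hGbound (ofLp y)) hp0.le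
    have hseg : ∀ t ∈ Set.Icc (0 : ℝ) 1,
        MemLp (fun y : EuclideanSpace ℝ (Fin d → ZMod Mb) => Gs (ofLp y)) (ENNReal.ofReal p)
            (multivariateGaussian 0 (mulMat (fun κ => mb κ + t * (ma κ - mb κ)))) ∧
          (∫ y, ‖Gs (ofLp y)‖ ^ p
              ∂(multivariateGaussian 0 (mulMat (fun κ => mb κ + t * (ma κ - mb κ))))) ^ (1 / p) ≤
            (s.factorial : ℝ) * C * (Ap ^ (1 / p) * W.midWeight k X φ) := by
      intro t ht
      rw [hmt_eq t]
      set νt := multivariateGaussian (0 : EuclideanSpace ℝ (Fin d → ZMod M))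
        (Matrix.circulant (fun x => 𝒞b x + t * (𝒞a x - 𝒞b x)) + constMat 1) with hνt
      set νt' := multivariateGaussian (0 : EuclideanSpace ℝ (Fin d → ZMod Mb))
        (Matrix.circulant (fun z => 𝒞b' z + t * (𝒞a' z - 𝒞b' z)) + constMat 1) with hνt'
      obtain ⟨hwpt_int, hwpt_le⟩ := integral_weight_rpow_multivariateGaussian_add_constMat_le W hWl hD
        (hpsd_t t ht) zero_le_one hp0 (hSp t ht) hX φ
      -- the norm powers on the big torus
      have hnormp : Integrable (fun y : EuclideanSpace ℝ (Fin d → ZMod M) => ‖G (ofLp y)‖ ^ p) νt := by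
        refine Integrable.mono' (hwpt_int.const_mul (((s.factorial : ℝ) * C) ^ p))
          (hGm.norm.rpow_const fun _ => Or.inr hp0.le).aestronglyMeasurable (ae_of_all _ fun y => ?_)
        rw [Real.norm_of_nonneg (by positivity)]
        exact hbound_p y
      -- transfer of the norm powers
      set gp : (↥S → ℝ) → ℝ := fun u => ‖g u‖ ^ p with hgp
      have hgpm : StronglyMeasurable gp := (hgcont.norm.rpow_const fun _ => Or.inr hp0.le).stronglyMeasurable
      have hnormp_eq : ∫ y, ‖G (ofLp y)‖ ^ p ∂νt = ∫ y, ‖Gs (ofLp y)‖ ^ p ∂νt' := by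
        have h := integral_comp_sel_multivariateGaussian_eq (hreg t ht) (hreg' t ht) (fun s : ↥S => (s : Fin d → ZMod M))
          (fun s : ↥S => e s) (fun s s' => hcov_t t s s.2 s' s'.2) hgpm
        simp only [hgp] at h
        simp_rw [hG_eq_g]
        exact h
      have hint_iff := integrable_comp_sel_multivariateGaussian_iff (hreg t ht) (hreg' t ht)
        (fun s : ↥S => (s : Fin d → ZMod M)) (fun s : ↥S => e s) (fun s s' => hcov_t t s s.2 s' s'.2) hgpm
      have hnormp' : Integrable (fun y : EuclideanSpace ℝ (Fin d → ZMod Mb) => ‖Gs (ofLp y)‖ ^ p) νt' := by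
        have h1 : Integrable (fun y : EuclideanSpace ℝ (Fin d → ZMod M) => gp (fun s : ↥S => (ofLp y) (s : Fin d → ZMod M))) νt := by
          refine hnormp.congr (ae_of_all _ fun y => ?_)
          simp only [hgp]
          rw [hG_eq_g]
        have h2 := hint_iff.1 h1
        simpa only [hgp] using h2
      refine ⟨?_, ?_⟩
      · rw [← integrable_norm_rpow_iff hGsm.aestronglyMeasurable hpE ENNReal.ofReal_ne_top,
          ENNReal.toReal_ofReal hp0.le]
        exact hnormp'
      · rw [← hnormp_eq]
        have h1 : ∫ y, ‖G (ofLp y)‖ ^ p ∂νt ≤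
            ((s.factorial : ℝ) * C) ^ p * (Ap * W.midWeight k X φ ^ p) := by
          calc ∫ y, ‖G (ofLp y)‖ ^ p ∂νt
              ≤ ∫ y, ((s.factorial : ℝ) * C) ^ p * W.weight k X (φ + ofLp y) ^ p ∂νt :=
                integral_mono_of_nonneg (ae_of_all _ fun y => by positivity)
                  (hwpt_int.const_mul _) (ae_of_all _ fun y => hbound_p y)
            _ = ((s.factorial : ℝ) * C) ^ p * ∫ y, W.weight k X (φ + ofLp y) ^ p ∂νt :=
                integral_const_mul _ _
            _ ≤ ((s.factorial : ℝ) * C) ^ p * (Ap * W.midWeight k X φ ^ p) :=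
                mul_le_mul_of_nonneg_left hwpt_le (by positivity)
        calc (∫ y, ‖G (ofLp y)‖ ^ p ∂νt) ^ (1 / p)
            ≤ (((s.factorial : ℝ) * C) ^ p * (Ap * W.midWeight k X φ ^ p)) ^ (1 / p) :=
              Real.rpow_le_rpow (integral_nonneg fun y => by positivity) h1 (by positivity)
          _ = (s.factorial : ℝ) * C * (Ap ^ (1 / p) * W.midWeight k X φ) := by
              rw [Real.mul_rpow (by positivity) (mul_nonneg hAp0 (by positivity)),
                Real.mul_rpow hAp0 (by positivity), ← Real.rpow_mul (by positivity),
                ← Real.rpow_mul hwm.le, mul_one_div_cancel hp0.ne', Real.rpow_one, Real.rpow_one]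
    -- (5) the dimension-free comparison along the small segment
    have hmain := norm_integral_mulMat_sub_le_of_sum_sq_segment (m₀ := mb) (m₁ := ma) (ρ := ρ)
      hmb_pos hma_pos hmb_ev hma_ev hρb hρa hhS hsum hpq
      (H := fun y : EuclideanSpace ℝ (Fin d → ZMod Mb) => Gs (ofLp y))
      (fun t ht => (hseg t ht).1) (fun t ht => (hseg t ht).2)
    refine hmain.trans (le_of_eq ?_)
    ring
  -- (6) sum over the Taylor orders
  show tayNorm T r₀ (fluct 𝒞a K - fluct 𝒞b K) φ ≤ _
  unfold tayNorm
  calc ∑ s ∈ Finset.range (r₀ + 1), ((s.factorial : ℝ)⁻¹) *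
        ‖iteratedFDeriv ℝ s (gaugeLift T (fluct 𝒞a K - fluct 𝒞b K)) (T.rangeRestrict φ)‖
      ≤ ∑ _s ∈ Finset.range (r₀ + 1), C * (8 * q * hS * Ap ^ (1 / p)) * W.midWeight k X φ := by
        refine sum_le_sum fun s hs => ?_
        have hs' : s ≤ r₀ := Nat.lt_succ_iff.1 (mem_range.1 hs)
        have hfac : (0 : ℝ) < s.factorial := by positivity
        calc ((s.factorial : ℝ)⁻¹) *
              ‖iteratedFDeriv ℝ s (gaugeLift T (fluct 𝒞a K - fluct 𝒞b K)) (T.rangeRestrict φ)‖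
            ≤ ((s.factorial : ℝ)⁻¹) *
                ((s.factorial : ℝ) * C * (8 * q * hS * Ap ^ (1 / p)) * W.midWeight k X φ) :=
              mul_le_mul_of_nonneg_left (hterm s hs') (by positivity)
          _ = C * (8 * q * hS * Ap ^ (1 / p)) * W.midWeight k X φ := by
              field_simp
    _ = C * ((r₀ + 1) * (8 * q * hS) * Ap ^ (1 / p)) * W.midWeight k X φ := by
        rw [sum_const, card_range, nsmul_eq_mul]
        push_cast
        ring

end Literature.MathematicalPhysics.StatisticalMechanics.GradientRG

end
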